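import Summits.QuantumFields.YangMills.Theorems.BalabanUVNodesN27AtAllPinsOfRecord13CoPHVCutBFreeSqueezedLedgerReading

/-!
# ★ MPQᴮ — storey APQᴮ (`…N27AtAllPinsOfRecord13CoPHVCutBFreeSqueezedLedgerReading`, dag-n27-c g16: APWᴮ with the N19′ slot at dag-n19-w3 g5's SQUEEZED LEDGER READING `hlinkSqzV`, `hunif` gone, `hρ` from
# `hs`, rows `hWall hradii hclass hβ23`) WITH THE ALL-PINS READING MINTED — the four v5∕v6 reading pins DISCHARGED (`rfl`), the link-reading face and every keyed bundle at the SPELLED BUNDLE OF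
# LETTERS, no rate reading `𝔯` in the statement (cell `pub-ymgap`, HUMAN RULING D-0062 Track A; WIDTH SEAT `pub-ymgap-dag-n27-w1` gen 4 on NODE n27 (B5 composite); dag-n27-c «(B)-free ∕ slot
# editions of n27-w1's minted storeys are YOUR lanes» l.35594; K3⁸ = stmt-QuantumFields-27366, `--kind proof --supports 27366 --as helper`; COUNT-NEUTRAL; THEOREMS ONLY, 0 `def`, 0 `sorry`;
# `N`∕`K₀`∕regime-generic, NO Theses import; siblings MPWᴮ · MPCᴮ)

WHY.  gen 3 (p608315 ∕ p609478) and gen 4 (`K3V6StubsLetterForm` p629121): the stub TEXTS ⟺ READING-FREE LETTER FORMS; the all-pins reading is MINTED for every letter choice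
(`𝔯 := ⟨fun F θ hP g₀ os ↦ ⟨objectsOfRecord₁₃ F N θ (ℓ F θ), fun _ ↦ loose N16 layer (ℓ₃, B), fun _ ↦ fullGSizedObjects 3 F.hL b a_S …⟩, ne1OfRecord l₀ Λ⟩`, four `rfl`) and its bundle IS the
spelled bundle of letters, so every all-pins storey ∕ leaf has a twin with NO rate reading in its statement: the parent's binders with the four pin lines REPLACED by
`(hl₀ : 0 < l₀) (hΛ : 0 ≤ Λ) (hb : 0 < b) (haS : 0 < aS)`, the link-reading faces' `let R := rateCarriersOfRecord₁₃CoPH 𝔯 …` and every other keyed bundle SPELLED; proofs = the parent's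
bodies VERBATIM behind the minting prelude (generator `gen_minted.py`, regression-identical on g3's APK ↦ MPK ∕ AKL ↦ MKL; g3's MPW p616290 ∕ MWL p617292 are the v5 precedents of exactly this edition).
* §1 ★★★ `bodyBFree₁₃CoPH_of_mintedV5Pins_squeezedLedgerReadingV_at_crOfRecord₁₃VAt_cut` (any `Rg`; per guarded admissible tuple).

HONEST FRAMING.  COMPOSITE-node bookkeeping BY NAME; a REDUCTION, not a discharge; `hlink`∕`hlinkSqzV`∕`hlinkCoreV` = NODE O's world at the runs of record — UNPRINTED content for d = 4, 0 instances; `hβw` =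
the K1 window currency (K1⁹ OPEN); every displayed antecedent is a HYPOTHESIS inhabited for no family today (K0⁷ `Record13SepCoPHInhabited` OPEN) or a decided MODEL inside the minted reading
(n14-w1's datum-read tower, dag-n15-a's sized genuine family — MODEL LEVEL, v5∕v6's own labels); the finite-volume kernel letters are Bałaban-type SHAPES NOT PRINTED as such for d = 4, proved
nowhere; THE END's N16 sentence a hypothesis; NE7b ∕ NE7c witnesses ∕ the N19′ edge 0∕1 today; nothing of Bałaban's asserted or instantiated; NOT `stub_rates13HV` ∕ `stub_expansion13HV`; N11 ∕
N14–N22 ∕ N27 NOT discharged; K3⁸ stmt-QuantumFields-27366 OPEN, NOT claimed; skeleton v6 and every landed decl UNTOUCHED; K3⁷ 20544 aside; counts UNMOVED (typed 28∕28 · discharged 5∕27, A 5∕28);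
one finite four-torus programme at fixed `ε` — R4 closes the CONDITIONAL finite-𝕋⁴ rung `BalabanLadder.UV` only: NOT ℝ⁴, NOT infinite volume, NOT OS, NOT a mass gap, NOT Clay.  No decl below carries a cite tag.
-/

set_option autoImplicit false

namespace Summit.QuantumFields.YangMills.Theorems.BalabanUVNodesN27SpineRecord

open scoped BigOperators Matrix Matrix.Norms.L2Operator
open Finset MeasureTheory
open Literature.MathematicalPhysics.QuantumFieldTheory.Balaban1983to89
open T4OutputRate T4RecentScale T4GoodClassBudget T4CauchySum T4TowerRateComposition T4TowerRateDischarge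
open T4EtaRateMin (Readings NE3Shape)
open T4RateLiaison (GaugeDominated)
open FlowStep (RGEqH prefixOf)
open TreeLengthTorus (TFaceConnected torusTreeLen)
open B12TreeDecay (kappa₀)
open Summit.QuantumFields.BalabanUV.T4Continuum
open AveragingDeficitDualResidual (dualC1 dualC2)
open AveragingDeficitDerivWallProof (wallConst)
open AveragingDeficitPeriodicCounting (IsPeriodicDir)
open MinimalActionSandwich (IsMinimiser minAct)
open MinimalActionRate (sfClass)
open MinimalActionRefine (RegularSup gradConst)
open NE3EnergyShapes (IsUnitarySite IsPeriodicSite)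
open NE3.LeafIndexSockets (LeafH3sup)
open Summit.QuantumFields.BalabanUV.T4Continuum.Spine
open Summit.QuantumFields.BalabanUV.T4Continuum.Spine.NE4 (runFlow)
open Summit.QuantumFields.BalabanUV.T4Continuum.NE1p.DressedRoot (DressedTower DressedStabilityStrict)
open Summit.QuantumFields.YangMills.BalabanUVNodes.N19LedgerLinkSync (LedgerDataSync LedgerAtSync)
open YMDAG.UVSplit
open Summit.QuantumFields.YangMills.BalabanUVNodes.N16HolderDefs (CovRootHolder N16HolderAt)
open Summit.QuantumFields.YangMills.BalabanUVNodes.SpineRatesHolder (RatesHolderAt)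
open Literature.MathematicalPhysics.QuantumFieldTheory.Balaban1983to89.T4Continuum (T4Family ULoop)
open Node00 (Stage13HParams datumOfRecord₁₃CoPH SiteSeqKey U3Letters₁₁ NE3Letters₁₁ ne3ConstLayerOfRecord₁₁ ne3NperOfRecord₁₁ ne3DomOfRecord₁₁ ZetaMeasurable ppSelLiveOfRecord
  EOfRecord₁₃ wOfRecord₉ localBgMeasurable)
open Literature.MathematicalPhysics.QuantumFieldTheory.Balaban1983to89.B12Sec2to5 (betaPrime510)
open Literature.MathematicalPhysics.QuantumFieldTheory.Balaban1983to89.Node00.U3OfKernels (objectsOfRecord₁₃ KernelDecayOfRecord₁₃)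
open Literature.MathematicalPhysics.QuantumFieldTheory.Balaban1983to89.Node00.U3KernelLetters (GeometricIncrementsOfRecord₁₃ WindowedNE9OfRecord₁₃ WindowedDecayOfRecord₁₃
  WindowedStepRateOfRecord₁₃)
open Summit.QuantumFields.YangMills.BalabanUVNodes.N16PinnedLayer13CoPH (N16PinnedLoose N16LettersEnd rateCarriers_ne3_of_pinnedLoose)
open T4WeightBudget (RelWeightBound)
open T4IndicatorShell (ShellWeightBound)
open T4ContinuumYM4Torus (ForSmallCouplings)
open T4ApexHybrid (HybridNE7Under StringwiseHybridNE7)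
open Summit.QuantumFields.YangMills.BalabanUVNodes.N19CoreEdgeFSCComposer (keyedGuarded₁₃CoPH_of_keyedFacesP_fsc)
open Summit.QuantumFields.YangMills.BalabanUVNodes.N19RateEdgeHolderD4AtSqueezedLedgerReadingV (keyedCoreEdgeHolderD4BFree_crOfRecord₁₃VAt_of_linkReadingAtSqueezedLedgerReadingV_finiteVolumeRows)
open Summit.QuantumFields.YangMills.BalabanUVNodes.SpineCanonicalWeights (core_nonneg_of_shellWeightBound)
open Summit.QuantumFields.YangMills.BalabanUVNodes.N19TargetClassWeightsE1Keyed
open Summit.QuantumFields.YangMills.BalabanUVNodes.N21KeyedShellWeightShellZero (zeta_nonneg_of_provisos₁₃CoPH)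
open YMDAG.N14.TopBorn (ne1OfRecord Ne1PinnedOfRecord n14At_rateCarriersOfRecord₁₃CoPH_of_pinned)
open Summit.QuantumFields.YangMills.BalabanUVNodes.N15.GenuineRecord (fullGSizedObjects n15At_fullGSizedObjects_family)
open Summit.QuantumFields.YangMills.BalabanUVNodes.N15.AtKeyedHome (neZero_blockFactor)
open YMDAG.N18.PolLimitRate (u3KernelInputs_of_finiteVolumeLetters)

variable {N : ℕ} [NeZero N] (K₀ : ℕ)
  (jc : (F : T4Family) → (θ : Stage13HParams F N) → θ.Provisos₁₃CoPH F N → (ℕ → ℝ) → List (ULoop F) → ℕ → ℕ)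
  (sh : ShellSplit₁₃CoPH N K₀) (β : ℝ)
  -- the LETTERS of the minted reading (N14 tower `l₀ Λ`; the sized genuine N15 family `b a_S ν μ α β′ c₃₅ p`; N16's letters `ℓ₃`, radius letter `B`; U3 block `ℓ` below)
  (l₀ Λ b aS : ℝ) (ν μ α β' : Fin 4) (c35 p : ℝ)
  (ℓ : (F : T4Family) → Stage13HParams F N → U3Letters₁₁) (s : (F : T4Family) → Stage13HParams F N → ℕ) (r : (F : T4Family) → Stage13HParams F N → ℝ)
  (ℓ₃ : T4Family → NE3Letters₁₁) (g B c' : T4Family → ℝ)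

/-! ## §1 Every v6 slot at its producer, K5 at the per-tuple-cut spine reading of record, N19′ ⟸ the SQUEEZED LEDGER READING at that reading (any regime, `hsel` per tuple) — with the reading MINTED -/

/-- ★★★ **THE (B)-FREE SPINE BODY ON A REGIME FROM THE MINTED ALL-PINS READING, N19′ ⟸ NODE O's LINK READING at the pinned spine reading** — the parent's theorem with
its four pin hypotheses DISCHARGED by the minted reading (`rfl`); every other binder VERBATIM, the link-reading face at the SPELLED bundle.  No rate reading in the statement.  NOT a discharge;
every row a HYPOTHESIS (NODE O's world UNPRINTED, 0 instances; K1 window open) or a decided MODEL; no stub closed. [bookkeeping] -/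
theorem bodyBFree₁₃CoPH_of_mintedV5Pins_squeezedLedgerReadingV_at_crOfRecord₁₃VAt_cut (Rg : (F : T4Family) → Stage13HParams F N → Prop)
    (ksel : (F : T4Family) → (θ : Stage13HParams F N) → θ.Provisos₁₃CoPH F N → (ℕ → ℝ) → List (ULoop F) → ℕ)
    (hl₀ : 0 < l₀) (hΛ : 0 ≤ Λ) (hb : 0 < b) (haS : 0 < aS)
    (h16 : ∀ (F : T4Family), (∃ θ : Stage13HParams F N, θ.Provisos₁₃CoPH F N ∧ Rg F θ ∧ θ.Admissible F N) →
      N16HolderAt (ne3OfRecord₁₁ F { ne3ConstLayerOfRecord₁₁ F N (ℓ₃ F) with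
        dom := {V | V ∈ ne3DomOfRecord₁₁ F N 0 0 ∧ V ∈ sfClass 4 F.L (ne3NperOfRecord₁₁ F 0 0) ((ℓ₃ F).ε / B F) 0} }) β)
    (hs : ∀ (F : T4Family) (θ : Stage13HParams F N), θ.Provisos₁₃CoPH F N → Rg F θ → θ.Admissible F N → (ℓ F θ).Signs)
    (hκ : ∀ (F : T4Family) (θ : Stage13HParams F N), θ.Provisos₁₃CoPH F N → Rg F θ → θ.Admissible F N → 0 < (ℓ F θ).κ)
    (hcr : ∀ (F : T4Family) (θ : Stage13HParams F N), θ.Provisos₁₃CoPH F N → Rg F θ → θ.Admissible F N →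
      betaPrime510 4 1 (ℓ F θ).κ ≤ (ℓ F θ).cr)
    (hr : ∀ (F : T4Family) (θ : Stage13HParams F N), θ.Provisos₁₃CoPH F N → Rg F θ → θ.Admissible F N → r F θ < 1)
    (hinc : ∀ (F : T4Family) (θ : Stage13HParams F N), θ.Provisos₁₃CoPH F N → Rg F θ → θ.Admissible F N →
      GeometricIncrementsOfRecord₁₃ F N θ.toStage13Params (r F θ))
    (hS : ∀ (F : T4Family) (θ : Stage13HParams F N), θ.Provisos₁₃CoPH F N → Rg F θ → θ.Admissible F N →
      WindowedStepRateOfRecord₁₃ F N θ.toStage13Params (s F θ) (ℓ F θ).κ (ℓ F θ).θ₅ ((ℓ F θ).C₅ * (ℓ F θ).θ₅))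
    (h9 : ∀ (F : T4Family) (θ : Stage13HParams F N), θ.Provisos₁₃CoPH F N → Rg F θ → θ.Admissible F N →
      WindowedNE9OfRecord₁₃ F N θ.toStage13Params (ℓ F θ).κ (ℓ F θ).moduli)
    (hWall : ∀ (μ ν : Fin 4) (F : T4Family) (θ : Stage13HParams F N), θ.Provisos₁₃CoPH F N → Rg F θ → θ.Admissible F N →
      WindowedDecayOfRecord₁₃ F N θ.toStage13Params μ ν (ℓ F θ).κ)
    (hβ23 : 2 / 3 < β) (hβ1 : β ≤ 1)
    (hmatch : ∀ F : T4Family, 0 < B F ∧ (ℓ₃ F).ε / B F ≤ (ℓ₃ F).b)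
    (hend : N16LettersEnd N g ℓ₃)
    (hradii : ∀ F : T4Family, (ℓ₃ F).g = gradConst 4 (c' F) ∧ 0 ≤ c' F ∧ 0 < c' F ∧ (ℓ₃ F).b ≤ c' F ∧
      (2 : ℝ) ^ 91 * (F.L : ℝ) ^ 17 * c' F ≤ 1 ∧ (2 : ℝ) ^ 76 * (F.L : ℝ) ^ 12 * c' F ≤ (ℓ₃ F).ε ∧ (ℓ₃ F).ε / B F ≤ 1 / 4 ∧ 4 * ((ℓ₃ F).ε / B F) ≤ c' F)
    (hclass : ∀ F : T4Family, 16 * B7Prop2Explicit.C0 4 * (ℓ₃ F).ε ≤ 3 ∧ 1024 * (4 + 1) * (4 + 4) * (F.L : ℝ) ^ 2 * (ℓ₃ F).ε ≤ 1)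
    (hβw : ∀ (F : T4Family) (θ : Stage13HParams F N) (hP : θ.Provisos₁₃CoPH F N), Rg F θ → θ.Admissible F N →
      ∃ γ₀ b b' : ℝ, 0 < γ₀ ∧ 0 < b ∧ DagBinding.BetaBoundsInInterval (datumOfRecord₁₃CoPH F N θ hP).C.toB12 γ₀ b b')
    (hsel : ∀ (F : T4Family) (θ : Stage13HParams F N), θ.Provisos₁₃CoPH F N → Rg F θ → θ.Admissible F N →
      ∃ E : B12.RunParams → ℝ, θ.ppSel = ppSelLiveOfRecord F N θ.ν θ.τ9 E (wOfRecord₉ F N θ.toStage9Params))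
    (hζm : ∀ (F : T4Family) (θ : Stage13HParams F N), θ.Provisos₁₃CoPH F N → Rg F θ → θ.Admissible F N → ZetaMeasurable F N θ.ζ)
    (h20 : ∀ (F : T4Family) (θ : Stage13HParams F N) (hP : θ.Provisos₁₃CoPH F N), Rg F θ → θ.Admissible F N →
      ∀ (g₀ : ℕ → ℝ) (os : List (ULoop F)),
        ∃ W : ℕ → ℝ, RelWeightBound 1 (classSet₁₃ θ K₀ g₀) (weightA₁₃ θ hP K₀ g₀ os) (weightB₁₃ θ hP K₀ g₀ os) (badClass₁₃ θ K₀ g₀ (jc F θ hP g₀ os)) W)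
    (h21 : ∀ (F : T4Family) (θ : Stage13HParams F N) (hP : θ.Provisos₁₃CoPH F N), Rg F θ → θ.Admissible F N →
      ∀ (g₀ : ℕ → ℝ) (os : List (ULoop F)),
        ∃ Wsh : ℕ → ℝ, ShellWeightBound 1 (classSet₁₃ θ K₀ g₀) (weightA₁₃ θ hP K₀ g₀ os) (weightB₁₃ θ hP K₀ g₀ os) (sh F θ hP g₀ os).1 (sh F θ hP g₀ os).2 Wsh)
    (hlinkSqzV : ∀ (F : T4Family) (θ : Stage13HParams F N) (hP : θ.Provisos₁₃CoPH F N), Rg F θ → θ.Admissible F N →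
      ∀ (γ gIR b : ℝ) (g₀ : ℕ → ℝ), (datumOfRecord₁₃CoPH F N θ hP).Tuned γ gIR g₀ → γ ≤ θ.γ → γ ^ 2 ≤ Real.exp (-1) → 0 < b →
      (∀ K m, 0 ≤ m → m < K → b ≤ (datumOfRecord₁₃CoPH F N θ hP).βfun m (prefixOf (runFlow (datumOfRecord₁₃CoPH F N θ hP) g₀ K) m)) →
      ∀ (os : List (ULoop F)) (k : ℕ),
        let S : SpineCarriers := crOfRecord₁₃VAt K₀ (jc F θ hP g₀ os) sh F θ hP g₀ os
        let R : RateCarriers N :=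
          ⟨ne1OfRecord l₀ Λ F θ hP g₀ os, ne2OfRecord₁₁ (haveI := neZero_blockFactor F; fullGSizedObjects 3 F.hL b aS ν μ α β' c35 p),
            ne3OfRecord₁₁ F { ne3ConstLayerOfRecord₁₁ F N (ℓ₃ F) with
              dom := {V | V ∈ ne3DomOfRecord₁₁ F N 0 0 ∧ V ∈ sfClass 4 F.L (ne3NperOfRecord₁₁ F 0 0) ((ℓ₃ F).ε / B F) 0} },
            u3OfRecord₁₃ θ.toStage13Params (objectsOfRecord₁₃ F N θ.toStage13Params (ℓ F θ)) k⟩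
        let D : Datum F N := datumOfRecord₁₃CoPH F N θ hP
        letI := S.dec
        ∃ (_ : DecidableEq R.u3.C.Dom) (F' : Type) (ι' X' : Type) (_ : MeasurableSpace ι')
          (L : LedgerDataSync R.u3.C F' ι' S.ι) (Rd : Readings ι' X') (bsel : (ℕ → ℝ) → ℝ) (EB : Functional R.u3.C R.u3.C.BgB)
          (g : ℕ → ℕ → ℝ)
          (uA : ℕ → ι' → R.u3.C.BgA) (uB : ℕ → ι' → R.u3.C.BgB)
          (Koff : ℕ) (cells : (K j : ℕ) → R.u3.C.Dom → Finset (Site (F.P (Koff + K)) j))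
          (H033 : Flow → ℕ → Prop) (I : Type) (fam : I → B14.Sect2Data) (Lb βw : ℝ) (κ₁ : ℕ) (Gv Cl : ℝ) (K₁ : ℕ)
          (θ : ℝ)
          (sel : ℕ → (B7Prop1Explicit.Site 4 → Fin 4 → (Matrix (Fin N) (Fin N) ℂ)ˣ) → (B7Prop1Explicit.Site 4 → Fin 4 → (Matrix (Fin N) (Fin N) ℂ)ˣ))
          (rd : ι' → (B7Prop1Explicit.Site 4 → Fin 4 → (Matrix (Fin N) (Fin N) ℂ)ˣ)),
          (∀ K i, i ≤ K → g K i = runFlow D g₀ K i) ∧ (∀ K i, K < i → g K i = gIR) ∧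
          EB = (fun s => R.u3.EB (bsel s) s) ∧
          (∀ (Sz : ℕ → ℝ → S.ι → ℕ → ℝ) (E₀ : ℝ) (m : ℕ) (a : ℝ) (Cw Λg : ℝ),
            (∀ K t, |t| ≤ S.l₀ → ∀ τ ∈ S.T K \ S.Bad K t, ∀ v ∈ Rd.dom, ∀ j ≤ K,
              |∑ X ∈ L.fac K t τ with R.u3.C.scale X = j,
                  (Real.log (Real.exp (EB (fun i => g (K + 1) (i + 1)) (uB K v) X
                      - EB (fun i => g (K + 1) (i + 1)) L.oneB X))
                    - Real.log (Real.exp (R.u3.EA (g K) (uA K v) X - R.u3.EA (g K) L.oneA X)))| ≤ Sz K t τ j) →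
            0 ≤ E₀ → 0 < a → a < 1 →
            (∀ K t, |t| ≤ S.l₀ → ∀ τ ∈ S.T K \ S.Bad K t, ∀ j ≤ K,
              Sz K t τ j ≤ S.vol * (E₀ * ((K : ℝ) + 1) ^ m * a ^ (K - j))) →
            (∀ K, Multiplicity (L.All K) R.u3.C.scale (fun X => Real.exp (-(R.u3.κ * R.u3.C.d X))) Cw S.vol Λg K) →
            (∀ K t, |t| ≤ S.l₀ → ∀ τ ∈ S.T K \ S.Bad K t,
              WindowMultiplicity (L.facO K t τ) L.scO L.wO Cw S.vol Λg (jlogOf L.Cl K) K) →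
            1 ≤ Λg → L.θ' ≤ Λg →
            LedgerAtSync { L with S := Sz, E₀ := E₀, m := m, a := a, Cw := Cw, Λg := Λg } S.l₀ S.vol S.T S.Bad
              (fun K t τ => S.A K t τ - S.shA K t τ) (fun K t τ => S.B K t τ - S.shB K t τ) Rd R.u3.EA EB R.u3.κ g uA uB
              R.u3.ω R.u3.ρ R.u3.θ (θ ^ ((3 : ℝ) * β - 2))) ∧
          (∀ K t, |t| ≤ S.l₀ → ∀ τ ∈ S.T K \ S.Bad K t,
            WindowMultiplicity (L.facO K t τ) L.scO L.wO L.Cw S.vol L.Λg (jlogOf L.Cl K) K) ∧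
          0 ≤ L.Cw ∧ 1 ≤ L.Λg ∧ L.θ' ≤ L.Λg ∧
          kappa₀ (4 * 2 ^ 4) (2 * 4) ≤ R.u3.κ ∧
          (∀ K, ∀ X ∈ L.All K,
            (cells K (R.u3.C.scale X + Koff) X).Nonempty ∧ TFaceConnected (cells K (R.u3.C.scale X + Koff) X)) ∧
          (∀ K j, Set.InjOn (cells K j) ↑((L.All K).filter fun X => R.u3.C.scale X + Koff = j)) ∧
          (∀ K, ∀ X ∈ L.All K, torusTreeLen (cells K (R.u3.C.scale X + Koff) X) ≤ R.u3.C.d X) ∧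
          B14.Thm2Printed H033 fam Lb βw κ₁ ∧ βw < 1 ∧ 0 < βw ∧ 1 < Lb ∧ 1 ≤ Gv ∧ 0 ≤ Cl ∧
          (∀ K t, |t| ≤ S.l₀ → ∀ τ ∈ S.T K \ S.Bad K t, ∀ j ≤ K, ∃ (i : I) (w : (fam i).Ω) (j' : ℕ),
            (fam i).flow.SatisfiesRG (fam i).K ∧ H033 (fam i).flow (fam i).K ∧ 1 ≤ j' ∧ j' ≤ (fam i).K ∧
            (fam i).K - j' = K - j ∧ (fam i).K ≤ K + K₁ ∧
            (∀ n, 0 ≤ (fam i).gammaVol n w) ∧ (fam i).gammaVol (fam i).K w ≤ S.vol ∧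
            (∀ n, n < (fam i).K → n < jlogOf Cl (fam i).K → (fam i).gammaVol n w = 0) ∧
            (∀ n, n < (fam i).K → jlogOf Cl (fam i).K ≤ n → (fam i).gammaVol n w ≤ S.vol * Gv ^ ((fam i).K - n))) ∧
          LeafH3sup 4 R.ne3.L R.ne3.Nper R.ne3.ε R.ne3.b (c' F) R.ne3.dom ∧
          (∀ V ∈ R.ne3.dom, ∀ k : ℕ, IsMinimiser 4 (sfClass 4 R.ne3.L R.ne3.Nper R.ne3.ε) R.ne3.L R.ne3.Nper k V (sel k V)) ∧
          (∀ V ∈ R.ne3.dom, ∀ k : ℕ, RegularSup 4 R.ne3.L R.ne3.Nper R.ne3.b (c' F) k (sel k V)) ∧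
          0 < θ ∧ θ ^ 6 = ((R.ne3.L : ℝ))⁻¹ ∧
          (∀ v ∈ Rd.dom, rd v ∈ R.ne3.dom) ∧
          (∀ k, ∀ v ∈ Rd.dom, Rd.act k v = minAct 4 (sfClass 4 R.ne3.L R.ne3.Nper R.ne3.ε) R.ne3.L R.ne3.Nper k (rd v)) ∧
          (R.ne3.Nper : ℝ) ^ 4 ≤ Rd.vol ∧
          (∀ s ∈ Window γ, 0 < bsel s ∧ bsel s ≤ γ))
    (F : T4Family) (θ : Stage13HParams F N) (hP : θ.Provisos₁₃CoPH F N) (hRg : Rg F θ) (hθ : θ.Admissible F N) :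
    ForSmallCouplings (datumOfRecord₁₃CoPH F N θ hP) fun g₀ => StringwiseHybridNE7 ((datumOfRecord₁₃CoPH F N θ hP).scheme g₀) := by
  let lit : (F : T4Family) → (θ : Stage13HParams F N) → θ.Provisos₁₃CoPH F N → (ℕ → ℝ) → List (ULoop F) → Literature.MathematicalPhysics.QuantumFieldTheory.Balaban1983to89.Node00.RateObjects₁₁ N :=
    fun F θ _ _ _ =>
      ⟨objectsOfRecord₁₃ F N θ.toStage13Params (ℓ F θ),
        fun _ => { ne3ConstLayerOfRecord₁₁ F N (ℓ₃ F) with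
          dom := {V | V ∈ ne3DomOfRecord₁₁ F N 0 0 ∧ V ∈ sfClass 4 F.L (ne3NperOfRecord₁₁ F 0 0) ((ℓ₃ F).ε / B F) 0} },
        fun _ => haveI := neZero_blockFactor F; fullGSizedObjects 3 F.hL b aS ν μ α β' c35 p⟩
  let 𝔯 : YMDAG.UVSplit.RateReading₁₃CoPH N := ⟨lit, YMDAG.N14.TopBorn.ne1OfRecord l₀ Λ⟩
  have hpin1 : YMDAG.N14.TopBorn.Ne1PinnedOfRecord 𝔯 := ⟨l₀, Λ, hl₀, hΛ, fun _ _ _ _ _ => rfl⟩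
  have hpin2 : ∃ (b aS : ℝ) (ν μ α β' : Fin 4) (c35 p : ℝ), 0 < b ∧ 0 < aS ∧
      ∀ (F : T4Family) (θ : Stage13HParams F N) (hP : θ.Provisos₁₃CoPH F N) (g₀ : ℕ → ℝ) (os : List (ULoop F)) (k : ℕ),
        (𝔯.lit F θ hP g₀ os).ne2 k = haveI := neZero_blockFactor F; fullGSizedObjects 3 F.hL b aS ν μ α β' c35 p :=
    ⟨b, aS, ν, μ, α, β', c35, p, hb, haS, fun _ _ _ _ _ _ => rfl⟩
  have hpinL : Summit.QuantumFields.YangMills.BalabanUVNodes.N16PinnedLayer13CoPH.N16PinnedLoose 𝔯 ℓ₃ B := fun _ _ _ _ _ _ => rfl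
  have hpin : ∀ (F : T4Family) (θ : Stage13HParams F N) (hP : θ.Provisos₁₃CoPH F N) (g₀ : ℕ → ℝ) (os : List (ULoop F)),
      (𝔯.lit F θ hP g₀ os).u3 = objectsOfRecord₁₃ F N θ.toStage13Params (ℓ F θ) := fun _ _ _ _ _ => rfl
  have hρ : ∀ (F : T4Family) (θ : Stage13HParams F N), θ.Provisos₁₃CoPH F N → Rg F θ → θ.Admissible F N →
      0 ≤ (ℓ F θ).ρ ∧ (ℓ F θ).ρ < 1 := fun F θ hP hRg hθ => ⟨(hs F θ hP hRg hθ).ρ_nonneg, (hs F θ hP hRg hθ).ρ_lt_one⟩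
  have hU := fun (F : T4Family) (θ : Stage13HParams F N) (hP : θ.Provisos₁₃CoPH F N) (hRg : Rg F θ) (hθ : θ.Admissible F N) =>
    u3KernelInputs_of_finiteVolumeLetters F N θ.toStage13Params (ℓ F θ) (hs F θ hP hRg hθ) (s F θ) (hr F θ hP hRg hθ) (hinc F θ hP hRg hθ) (hS F θ hP hRg hθ)
      (h9 F θ hP hRg hθ) (hWall 0 1 F θ hP hRg hθ)
  exact bodyBFree₁₃CoPH_of_keyedFacesP_bFree (fun F θ hP g₀ os => crOfRecord₁₃VAt K₀ (jc F θ hP g₀ os) sh F θ hP g₀ os)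
      (fun F θ hP g₀ os => rateCarriersOfRecord₁₃CoPH 𝔯 F θ hP g₀ os (ksel F θ hP g₀ os)) Rg
      (fun D R => RatesHolderAt D R β ∧ ReadOutAt D R.u3 ∧ (0 ≤ R.u3.ρ ∧ R.u3.ρ < 1))
      (fun F θ hP hRg hθ g₀ os => by
        obtain ⟨W, hW⟩ := h20 F θ hP hRg hθ g₀ os
        exact relWeightBound_crOfRecord₁₃VAt K₀ (jc F θ hP g₀ os) sh θ hP g₀ os hW)
      (fun F θ hP hRg hθ g₀ os => by
        obtain ⟨Wsh, hWsh⟩ := h21 F θ hP hRg hθ g₀ os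
        exact shellWeightBound_crOfRecord₁₃VAt K₀ (jc F θ hP g₀ os) sh θ hP g₀ os hWsh)
      (fun F θ hP hRg hθ => ForSmallCouplings.of_forall fun g₀ os =>
        pHolderD4Body_rateCarriers_of_kernels_pin 𝔯 θ hP g₀ os (ℓ F θ) (hpin F θ hP g₀ os) β (ksel F θ hP g₀ os)
          (n14At_rateCarriersOfRecord₁₃CoPH_of_pinned 𝔯 hpin1 F θ hP g₀ os (ksel F θ hP g₀ os))
          (by
            obtain ⟨b, aS, ν, μ, α, β', c35, p, hb, haS, h⟩ := hpin2
            rw [h F θ hP g₀ os]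
            exact n15At_fullGSizedObjects_family hb haS ν μ α β' c35 p F)
          (by
            show N16HolderAt (rateCarriersOfRecord₁₃CoPH 𝔯 F θ hP g₀ os (ksel F θ hP g₀ os)).ne3 β
            rw [rateCarriers_ne3_of_pinnedLoose hpinL F θ hP g₀ os (ksel F θ hP g₀ os)]
            exact h16 F ⟨θ, hP, hRg, hθ⟩)
          (hs F θ hP hRg hθ) (hκ F θ hP hRg hθ) (hcr F θ hP hRg hθ) (hρ F θ hP hRg hθ) (hU F θ hP hRg hθ).1 ((hU F θ hP hRg hθ).2.1 _)
          ((hU F θ hP hRg hθ).2.2 _))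
      (keyedCoreEdgeHolderD4BFree_crOfRecord₁₃VAt_of_linkReadingAtSqueezedLedgerReadingV_finiteVolumeRows K₀ jc sh 𝔯 (fun θ => Rg _ θ) hβ1 hlinkSqzV hβ23 hpin1 ℓ hpin
        hpinL hmatch hend hradii hclass hs r hr hinc h9 hWall ksel hβw)
      (fun F θ hP hRg hθ => by
        obtain ⟨E, hE⟩ := hsel F θ hP hRg hθ
        exact keyedExtraction_crOfRecord₁₃VAt_cut K₀ jc sh θ hP E hE (localBgMeasurable F N θ.ν) (hζm F θ hP hRg hθ) (zeta_nonneg_of_provisos₁₃CoPH F θ hP))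
      F θ hP hRg hθ

end Summit.QuantumFields.YangMills.Theorems.BalabanUVNodesN27SpineRecord
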